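import Literature.NumberTheory.LFunctions.MertensConjectureDisproofNumerics
import Literature.NumberTheory.LFunctions.MertensCertificate.Chunk00
import Literature.NumberTheory.LFunctions.MertensCertificate.Chunk01
import Literature.NumberTheory.LFunctions.MertensCertificate.Chunk02
import Literature.NumberTheory.LFunctions.MertensCertificate.Chunk03
import Literature.NumberTheory.LFunctions.MertensCertificate.Chunk04
import Literature.NumberTheory.LFunctions.MertensCertificate.Chunk05
import Literature.NumberTheory.LFunctions.MertensCertificate.Chunk06
import Literature.NumberTheory.LFunctions.MertensCertificate.Chunk07
import Literature.NumberTheory.LFunctions.MertensCertificate.Chunk08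
import Literature.NumberTheory.LFunctions.MertensCertificate.Chunk09
import Literature.NumberTheory.LFunctions.MertensCertificate.Chunk10
import Literature.NumberTheory.LFunctions.MertensCertificate.Chunk11
import Literature.NumberTheory.LFunctions.MertensCertificate.Chunk12
import Literature.NumberTheory.LFunctions.MertensCertificate.Chunk13
import Literature.NumberTheory.LFunctions.MertensCertificate.Chunk14
import Literature.NumberTheory.LFunctions.MertensCertificate.Chunk15
import Literature.NumberTheory.LFunctions.MertensCertificate.Chunk16
import Literature.NumberTheory.LFunctions.MertensCertificate.Chunk17
import Literature.NumberTheory.LFunctions.MertensCertificate.Chunk18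
import Literature.NumberTheory.LFunctions.MertensCertificate.Chunk19
import Literature.NumberTheory.LFunctions.MertensCertificate.Top
import HarnessLib

/-!
# Disproof of the Mertens conjecture: discharge of the Table 3 fact

Topic `Literature/NumberTheory/LFunctions` (summit `RiemannHypothesis`, inventory id rh.S22).
Sibling proof file of `MertensConjectureDisproofNumerics.lean`, discharging its one named fact
`Literature.NumberTheory.LFunctions.OdlyzkoTeRiele1985_table3`:

* there is a height `T ∈ (2515, 2516)` and values `y₊`, `y₋` with `Re h_K(y₊) > 1.06` and
  `Re h_K(y₋) < -1.009` for the Jurkat–Peyerimhoff weight `k(t) = g(t/T)` and the zeros of `ζ`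
  below `T` — A. M. Odlyzko, H. J. J. te Riele, *Disproof of the Mertens conjecture*, J. reine
  angew. Math. **357** (1985) 138–160, §4.3 Table 3 (lines 15 and 21), p. 155, with `T = γ₂₀₀₀ =
  2515.286…` ((4.1), p. 150).

The tree's certified recomputation of that table (`MertensCertificate.lean`, soundness lemmas
`ZetaNumerics.Mertens.checkChunk_sound`, `zetaZeroCount_of_checkTop`, `final_of_checkFinal`;
compiled block evaluations `MertensCertificate/Chunk00–19.lean`, `Top.lean`) works at the height
`T₀ = 2516 ∈ (γ₂₀₀₀, γ₂₀₀₁)`, which is *not* in the open interval `(2515, 2516)` of the fact. We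
therefore re-read the certificate with the height explicit (`certificate_heightT0`: a finite set
`Z` of `N(2516)` certified ordinates and the two strict bounds for the explicit sum
`Σ_{γ∈Z} 2 Re [g(γ/2516) e^{iγy}/((½+iγ)ζ'(½+iγ))]`), and move the height slightly below `2516`:

1. the zeros below `2516` are `½ ± iγ`, `γ ∈ Z` (`zeros_below_of_count_eq_card`), all with
   `γ < 2516`, so for every `T ∈ (max Z, 2516]` the zeros below `T` are the same, on the line and
   simple, and `Re h_K(y)` at height `T` is the explicit sum with weight `g(γ/T)`
   (`re_inghamSum_eq_sum_of_zeros`);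
2. `g` is continuous (`continuous_jurkatPeyerimhoffKernel`), so that sum is continuous in `T` at
   `T₀ = 2516` (`continuousAt_kernelSum`) and the two *strict* inequalities persist for `T` in a
   left neighbourhood of `2516`;
3. a `T ∈ (2515, 2516)` in that neighbourhood and above `max Z` witnesses the fact
   (`OdlyzkoTeRiele1985_table3_holds`).

(In the paper `T = γ₂₀₀₀` itself, where `k(γ₂₀₀₀) = g(1) = 0`; the fact only records
`T ∈ (2515, 2516)`, and any such `T` close to `2516` works by continuity.)

## Axioms

`OdlyzkoTeRiele1985_table3_holds` depends on `propext`, `Classical.choice`, `Quot.sound` and on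
the 22 `native_decide` auxiliary axioms of `MertensCertificate.ZetaNumerics.Mertens.checkChunk_00`
… `checkChunk_19`, `checkTop_holds`, `checkFinal_holds` (trust in the Lean compiler, the
`Lean.ofReduceBool` family), exactly as `OdlyzkoTeRiele1985_numerics_holds`
(`RHWave0MertensProofs.lean`) — the printed proof is itself a machine computation (§4.2–4.4).
Proposal flag `computational`.

## References

* [OdlyzkoTeRiele1985] A. M. Odlyzko, H. J. J. te Riele, *Disproof of the Mertens conjecture*,
  J. reine angew. Math. 357 (1985), 138–160 — §4.1 (4.1) p. 150 (`T = γ₂₀₀₀`), §4.2 p. 151 (the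
  2000 zeros), §4.3 Table 3 (lines 15, 21) p. 155.
-/

noncomputable section

open Complex Filter
open scoped Real Topology

namespace Literature.NumberTheory.LFunctions

namespace MertensTable3

open ZetaNumerics.Mertens MertensCertificate.ZetaNumerics.Mertens

/-! ## The certificate re-read at the explicit height `T₀ = 2516` -/

/-- Continuity in the height: for a finite set `Z` of ordinates and fixed `y`, the explicit sum
`G_Z(y, T) = Σ_{γ ∈ Z} 2 Re [g(γ/T) e^{iγy} / ((½+iγ) ζ'(½+iγ))]` (the right-hand side of
`re_inghamSum_eq_sum_of_zeros` for the weight `k(t) = g(t/T)` of (4.1)) is continuous at every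
`T₀ ≠ 0`, because the Jurkat–Peyerimhoff kernel `g` is continuous
(`continuous_jurkatPeyerimhoffKernel`). [cite: OdlyzkoTeRiele1985, §4.1 (4.1) p. 150] -/
theorem continuousAt_kernelSum (Z : Finset ℝ) (y : ℝ) {T₀ : ℝ} (hT₀ : T₀ ≠ 0) :
    ContinuousAt (fun T : ℝ ↦ ∑ γ ∈ Z, 2 * (((jurkatPeyerimhoffKernel (γ / T) : ℝ) : ℂ) *
      cexp (I * (γ * y)) / ((1 / 2 + γ * I) * deriv riemannZeta (1 / 2 + γ * I))).re) T₀ := by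
  have key : ∀ γ ∈ Z, ContinuousAt (fun T : ℝ ↦ 2 * (((jurkatPeyerimhoffKernel (γ / T) : ℝ) : ℂ) *
      cexp (I * (γ * y)) / ((1 / 2 + γ * I) * deriv riemannZeta (1 / 2 + γ * I))).re) T₀ := by
    intro γ _
    have h1 : ContinuousAt (fun T : ℝ ↦ γ / T) T₀ := continuousAt_const.div₀ continuousAt_id hT₀
    have h2 : ContinuousAt (fun T : ℝ ↦ ((jurkatPeyerimhoffKernel (γ / T) : ℝ) : ℂ)) T₀ :=
      (Complex.continuous_ofReal.comp continuous_jurkatPeyerimhoffKernel).continuousAt.comp' h1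
    have h3 : ContinuousAt (fun T : ℝ ↦ ((jurkatPeyerimhoffKernel (γ / T) : ℝ) : ℂ) *
        cexp (I * (γ * y)) / ((1 / 2 + γ * I) * deriv riemannZeta (1 / 2 + γ * I))) T₀ :=
      (h2.mul continuousAt_const).div_const _
    exact continuousAt_const.mul (Complex.continuous_re.continuousAt.comp' h3)
  exact tendsto_finsetSum Z fun γ hγ ↦ key γ hγ

/-- The checker's summand `otrTerm y γ = 2 Re [k(γ) e^{iγy} / (ρ ζ'(ρ))]`, `k(t) = g(t/T₀)`, with the
height written as the real number `2516`. [folklore] -/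
lemma otrTerm_eq (y γ : ℝ) :
    otrTerm y γ = 2 * (((jurkatPeyerimhoffKernel (γ / 2516) : ℝ) : ℂ) * cexp (I * (γ * y)) /
      ((1 / 2 + γ * I) * deriv riemannZeta (1 / 2 + γ * I))).re := by
  unfold otrTerm kT
  rw [heightT0_real]

/-- **The certificate at the explicit height `T₀ = 2516`.** There is a finite set `Z` of
ordinates of zeros of `ζ` on the critical line with `0 < γ < 2516` for `γ ∈ Z` and
`N(2516) = |Z|` (the 2000 certified brackets and the winding certificate along `[½, 2] × {2516}`),
such that `Σ_{γ∈Z} 2 Re [g(γ/2516) e^{iγy} / (ρ ζ'(ρ))]` is `> 1.06` at `y = y₊` and `< -1.009` at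
`y = y₋`, the two `y` of Table 3, lines 15 and 21. This is the content of
`ZetaNumerics.Mertens.numerics_of_checks` with the height and the sums kept explicit (same
proof). [cite: OdlyzkoTeRiele1985, §4.3 Table 3 (lines 15, 21) p. 155, with §4.2 p. 151] -/
theorem certificate_heightT0 :
    ∃ Z : Finset ℝ, (∀ γ ∈ Z, riemannZeta (1 / 2 + γ * I) = 0 ∧ 0 < γ ∧ γ < (heightT0 : ℝ)) ∧
      zetaZeroCount heightT0 = Z.card ∧
      (1.06 : ℝ) < ∑ γ ∈ Z, otrTerm yPlus γ ∧ ∑ γ ∈ Z, otrTerm yMinus γ < -1.009 := by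
  classical
  -- the twenty compiled blocks (as in `OdlyzkoTeRiele1985_numerics_holds`)
  have hCh : ∀ k < NCHUNK, checkChunk k = true := by
    intro k hk
    have hk20 : k < 20 := hk
    interval_cases k
    · exact checkChunk_00
    · exact checkChunk_01
    · exact checkChunk_02
    · exact checkChunk_03
    · exact checkChunk_04
    · exact checkChunk_05
    · exact checkChunk_06
    · exact checkChunk_07
    · exact checkChunk_08
    · exact checkChunk_09
    · exact checkChunk_10
    · exact checkChunk_11
    · exact checkChunk_12
    · exact checkChunk_13
    · exact checkChunk_14
    · exact checkChunk_15
    · exact checkChunk_16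
    · exact checkChunk_17
    · exact checkChunk_18
    · exact checkChunk_19
  have hNZ : NZ = NCHUNK * CHUNK := by unfold NZ NCHUNK CHUNK; norm_num
  -- per-zero facts
  have hfact : ∀ j < NZ, orderOk j = true ∧
      ∃ γ ∈ Set.Icc (t₁ j) (t₂ j), riemannZeta (1 / 2 + γ * I) = 0 := by
    intro j hj
    have hk : j / CHUNK < NCHUNK := by
      rw [hNZ] at hj; exact Nat.div_lt_of_lt_mul (by rwa [mul_comm] at hj)
    have hi : j % CHUNK < CHUNK := Nat.mod_lt _ (by unfold CHUNK; norm_num)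
    have := (checkChunk_sound (hCh _ hk)).1 (j % CHUNK) hi
    rwa [Nat.div_add_mod'] at this
  -- the ordinates
  set γ : ℕ → ℝ := fun j ↦ if h : j < NZ then (hfact j h).2.choose else 0 with hγdef
  have hγ : ∀ j < NZ, γ j ∈ Set.Icc (t₁ j) (t₂ j) ∧ riemannZeta (1 / 2 + γ j * I) = 0 := by
    intro j hj
    have := (hfact j hj).2.choose_spec
    simp only [hγdef, dif_pos hj]
    exact this
  have hord : ∀ j < NZ, 2 ≤ t₁ j ∧ t₂ j < heightT0 ∧ (j + 1 < NZ → t₂ j < t₁ (j + 1)) := by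
    intro j hj
    obtain ⟨h1, h2, h3⟩ := orderOk_sound (hfact j hj).1
    have h2p : (0 : ℝ) < 2 ^ 240 := by positivity
    refine ⟨?_, ?_, fun hj1 ↦ ?_⟩
    · unfold t₁; rw [le_div_iff₀ h2p]; exact_mod_cast h1
    · unfold t₂; rw [div_lt_iff₀ h2p]; exact_mod_cast h2
    · unfold t₁ t₂; rw [div_lt_div_iff_of_pos_right h2p]; exact_mod_cast h3 hj1
  have ht12 : ∀ j, t₁ j < t₂ j := fun j ↦ by
    unfold t₁ t₂; gcongr; linarith
  have hsep : ∀ j j', j < j' → j' < NZ → t₂ j < t₁ j' := by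
    intro j j' hjj' hj'
    induction j' with
    | zero => exact absurd hjj' (Nat.not_lt_zero _)
    | succ j' ih =>
      rcases Nat.lt_succ_iff_lt_or_eq.1 hjj' with hlt | heq
      · have := ih hlt (by omega)
        have h2 := (hord j' (by omega)).2.2 hj'
        linarith [ht12 j']
      · subst heq; exact (hord j (by omega)).2.2 hj'
  have hinj : Set.InjOn γ (Finset.range NZ : Set ℕ) := by
    intro j hj j' hj' h
    simp only [Finset.coe_range, Set.mem_Iio] at hj hj'
    by_contra hne
    rcases lt_or_gt_of_ne hne with hlt | hlt
    · have := hsep j j' hlt hj'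
      linarith [(hγ j hj).1.2, (hγ j' hj').1.1]
    · have := hsep j' j hlt hj
      linarith [(hγ j' hj').1.2, (hγ j hj).1.1]
  set Z : Finset ℝ := (Finset.range NZ).image γ with hZdef
  have hZcard : Z.card = NZ := by
    rw [hZdef, Finset.card_image_of_injOn hinj, Finset.card_range]
  have hZ : ∀ γ' ∈ Z, riemannZeta (1 / 2 + γ' * I) = 0 ∧ 0 < γ' ∧ γ' < heightT0 := by
    intro γ' hγ'
    rw [hZdef, Finset.mem_image] at hγ'
    obtain ⟨j, hj, rfl⟩ := hγ'
    rw [Finset.mem_range] at hj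
    obtain ⟨hI, h0⟩ := hγ j hj
    obtain ⟨h1, h2, -⟩ := hord j hj
    exact ⟨h0, by linarith [hI.1], by linarith [hI.2]⟩
  -- the count
  have hN : zetaZeroCount heightT0 = Z.card := by
    rw [zetaZeroCount_of_checkTop checkTop_holds, hZcard]; rfl
  -- the sums
  have hsum : ∀ y : ℝ, ∑ γ' ∈ Z, otrTerm y γ' =
      ∑ k ∈ Finset.range NCHUNK, ∑ i ∈ Finset.range CHUNK, otrTerm y (γ (k * CHUNK + i)) := by
    intro y
    rw [hZdef, Finset.sum_image hinj, hNZ, sum_range_mul]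
  have hbounds : ∀ k < NCHUNK,
      ((chunkBounds.getD k (0, 0)).1 : ℝ) / 2 ^ 60 ≤
          ∑ i ∈ Finset.range CHUNK, otrTerm yPlus (γ (k * CHUNK + i)) ∧
        ∑ i ∈ Finset.range CHUNK, otrTerm yMinus (γ (k * CHUNK + i)) ≤
          ((chunkBounds.getD k (0, 0)).2 : ℝ) / 2 ^ 60 := by
    intro k hk
    refine (checkChunk_sound (hCh k hk)).2 γ fun i hi ↦ (hγ _ ?_).1
    rw [hNZ]
    calc k * CHUNK + i < k * CHUNK + CHUNK := by omega
      _ = (k + 1) * CHUNK := by ring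
      _ ≤ NCHUNK * CHUNK := Nat.mul_le_mul_right _ hk
  obtain ⟨hFL, hFU⟩ := final_of_checkFinal checkFinal_holds
  have hplus : (1.06 : ℝ) < ∑ γ' ∈ Z, otrTerm yPlus γ' := by
    rw [hsum]
    refine hFL.trans_le ?_
    unfold sumL
    push_cast
    rw [Finset.sum_div]
    exact Finset.sum_le_sum fun k hk ↦ (hbounds k (Finset.mem_range.1 hk)).1
  have hminus : ∑ γ' ∈ Z, otrTerm yMinus γ' < -1.009 := by
    rw [hsum]
    refine lt_of_le_of_lt ?_ hFU
    unfold sumU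
    push_cast
    rw [Finset.sum_div]
    exact Finset.sum_le_sum fun k hk ↦ (hbounds k (Finset.mem_range.1 hk)).2
  exact ⟨Z, hZ, hN, hplus, hminus⟩

/-- **Moving the height below `2516`.** From the certificate at `T₀ = 2516`: there are a height
`T ∈ (2515, 2516)` and a finite set `Z` of ordinates of zeros of `ζ` on the line with
`0 < γ < T` (`γ ∈ Z`) such that every zero of `ζ` with `0 < Re ρ < 1`, `|Im ρ| < T` is on the line
and simple, every such zero with `Im ρ > 0` has its ordinate in `Z`, and the explicit sums at
height `T` satisfy `Σ_{γ∈Z} 2 Re [g(γ/T) e^{iγy₊}/(ρζ'(ρ))] > 1.06`,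
`Σ_{γ∈Z} 2 Re [g(γ/T) e^{iγy₋}/(ρζ'(ρ))] < -1.009` (all ordinates are `< 2516`, and the strict
bounds at `2516` persist on a left neighbourhood of `2516` by `continuousAt_kernelSum`).
[cite: OdlyzkoTeRiele1985, §4.1 (4.1) p. 150 (T = γ₂₀₀₀ = 2515.286…) and §4.3 Table 3 p. 155] -/
theorem exists_height :
    ∃ Z : Finset ℝ, ∃ T : ℝ, 2515 < T ∧ T < 2516 ∧
      (∀ γ ∈ Z, riemannZeta (1 / 2 + γ * I) = 0 ∧ 0 < γ ∧ γ < T) ∧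
      (∀ ρ : ℂ, riemannZeta ρ = 0 → 0 < ρ.re → ρ.re < 1 → |ρ.im| < T →
        ρ.re = 1 / 2 ∧ deriv riemannZeta ρ ≠ 0) ∧
      (∀ ρ : ℂ, riemannZeta ρ = 0 → 0 < ρ.re → ρ.re < 1 → 0 < ρ.im → ρ.im < T → ρ.im ∈ Z) ∧
      (1.06 : ℝ) < ∑ γ ∈ Z, 2 * (((jurkatPeyerimhoffKernel (γ / T) : ℝ) : ℂ) *
        cexp (I * (γ * yPlus)) / ((1 / 2 + γ * I) * deriv riemannZeta (1 / 2 + γ * I))).re ∧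
      ∑ γ ∈ Z, 2 * (((jurkatPeyerimhoffKernel (γ / T) : ℝ) : ℂ) *
        cexp (I * (γ * yMinus)) / ((1 / 2 + γ * I) * deriv riemannZeta (1 / 2 + γ * I))).re
        < -1.009 := by
  obtain ⟨Z, hZ, hN, hplus, hminus⟩ := certificate_heightT0
  rw [heightT0_real] at hZ hN
  simp only [otrTerm_eq] at hplus hminus
  obtain ⟨hclause, hall⟩ := zeros_below_of_count_eq_card Z hZ hN
  have e1 : ∀ᶠ T in 𝓝 (2516 : ℝ), ∀ γ ∈ Z, γ < T :=
    (Filter.eventually_all_finset Z).2 fun γ hγ ↦ eventually_gt_nhds (hZ γ hγ).2.2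
  have e2 : ∀ᶠ T in 𝓝 (2516 : ℝ), (1.06 : ℝ) < ∑ γ ∈ Z, 2 * (((jurkatPeyerimhoffKernel (γ / T) : ℝ) : ℂ) *
      cexp (I * (γ * yPlus)) / ((1 / 2 + γ * I) * deriv riemannZeta (1 / 2 + γ * I))).re :=
    continuousAt_const.eventually_lt (continuousAt_kernelSum Z yPlus (by norm_num)) hplus
  have e3 : ∀ᶠ T in 𝓝 (2516 : ℝ), ∑ γ ∈ Z, 2 * (((jurkatPeyerimhoffKernel (γ / T) : ℝ) : ℂ) *
      cexp (I * (γ * yMinus)) / ((1 / 2 + γ * I) * deriv riemannZeta (1 / 2 + γ * I))).re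
        < -1.009 :=
    (continuousAt_kernelSum Z yMinus (by norm_num)).eventually_lt continuousAt_const hminus
  have e4 : ∀ᶠ T in 𝓝 (2516 : ℝ), (2515 : ℝ) < T := eventually_gt_nhds (by norm_num)
  obtain ⟨T, hT, h1, h2, h3, h4⟩ := (e1.and (e2.and (e3.and e4))).exists_lt
  exact ⟨Z, T, h4, hT, fun γ hγ ↦ ⟨(hZ γ hγ).1, (hZ γ hγ).2.1, h1 γ hγ⟩,
    fun ρ h0 hr0 hr1 him ↦ hclause ρ h0 hr0 hr1 (him.trans hT),
    fun ρ h0 hr0 hr1 him0 him ↦ hall ρ h0 hr0 hr1 him0 (him.trans hT), h2, h3⟩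

end MertensTable3

open MertensTable3 ZetaNumerics.Mertens in
/-- **Discharge of `OdlyzkoTeRiele1985_table3`** (Odlyzko–te Riele 1985, §4.3 Table 3, lines 15
and 21, p. 155: `h_K(y₊) = 1.061545 > 1.06`, `h_K(y₋) = -1.009749 < -1.009`, weight `k(t) = g(t/T)`
of (4.1), p. 150, at a height `T ∈ (2515, 2516)`). From the tree's certified recomputation at
`T₀ = 2516` (`MertensCertificate.lean` and its compiled blocks) moved to a height `T < 2516` by
continuity of `g` (`MertensTable3.exists_height`): at such `T` the zeros below `T` are the
certified ones, on the line and simple, `Re h_K(y) = G_Z(y, T)` (`re_inghamSum_eq_sum_of_zeros`),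
and the two strict bounds hold. [cite: OdlyzkoTeRiele1985, §4.3 Table 3 (lines 15, 21) p. 155, with (4.1) p. 150] -/
theorem OdlyzkoTeRiele1985_table3_holds : OdlyzkoTeRiele1985_table3 := by
  obtain ⟨Z, T, hT1, hT2, hZ, hclause, hall, hplus, hminus⟩ := exists_height
  have hline : ∀ ρ : ℂ, riemannZeta ρ = 0 → 0 < ρ.re → ρ.re < 1 → |ρ.im| < T → ρ.re = 1 / 2 :=
    fun ρ h0 hr0 hr1 him ↦ (hclause ρ h0 hr0 hr1 him).1
  have hk_even : ∀ t : ℝ, (fun t : ℝ ↦ (jurkatPeyerimhoffKernel (t / T) : ℂ)) (-t) =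
      (fun t : ℝ ↦ (jurkatPeyerimhoffKernel (t / T) : ℂ)) t := fun t ↦ by
    simp only [neg_div, jurkatPeyerimhoffKernel_neg]
  have hk_real : ∀ t : ℝ, (starRingEnd ℂ) ((fun t : ℝ ↦ (jurkatPeyerimhoffKernel (t / T) : ℂ)) t) =
      (fun t : ℝ ↦ (jurkatPeyerimhoffKernel (t / T) : ℂ)) t := fun t ↦ Complex.conj_ofReal _
  have hre : ∀ y : ℝ, (inghamSum (fun t : ℝ ↦ (jurkatPeyerimhoffKernel (t / T) : ℂ)) T y).re =
      ∑ γ ∈ Z, 2 * (((jurkatPeyerimhoffKernel (γ / T) : ℝ) : ℂ) * cexp (I * (γ * y)) /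
        ((1 / 2 + γ * I) * deriv riemannZeta (1 / 2 + γ * I))).re := fun y ↦
    re_inghamSum_eq_sum_of_zeros Z hZ hline hall _ hk_even hk_real y
  exact ⟨T, hT1, hT2, ⟨yPlus, by rw [hre]; exact hplus⟩, ⟨yMinus, by rw [hre]; exact hminus⟩⟩

end Literature.NumberTheory.LFunctions

end
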